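/-
Cell b2b-lgcu-borel (gen 25).  VALUE = THEOREM (a member law for every hypothetical level-one design
triple in `GL₃(𝔽_p)`, all primes `p`), NOT summit progress; the crux item `SubgroupIdentityDesigns`
(stmt-MatrixMultiplication-14079) stays open and untouched.
-/
import Mathlib
import Summits.MatrixMultiplication.MatrixMultiplication.Theorems.SubgroupIdentityDesigns.Negative.RootChainFrames

/-!
# No member of a level-one design triple in `GL₃(𝔽_p)` has order divisible by `p³`

Route `LevelGradedCohnUmans`, crux `SubgroupIdentityDesigns` (stmt-MatrixMultiplication-14079), cell
`(m, k) = (3, 1)`; report `run/shared/lean/b2b/levelgraded-cu/ORACLE-g25.md` §G25-3.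

`RootChain` / `RootChainFrames` exclude a level-one identity design as soon as the products
`H₁ H₂ H₃` cover `x (U ∖ 1) x⁻¹` for the standard unitriangular group `U = U₃(𝔽_p)` and SOME frame
`x ∈ GL₃(𝔽_p)` — the conjugator being a hypothesis.  This file supplies the conjugator from SYLOW
THEORY and turns the certificate into an intrinsic ORDER LAW:

* `card_U` : `|U| = p³`;  `factorization_card_GL3` : `v_p |GL₃(𝔽_p)| = 3`
  (`|GL₃(𝔽_p)| = (p³−1)(p³−p)(p³−p²)`, `Matrix.card_GL_field`), so `U` is a Sylow `p`-subgroup of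
  `GL₃(𝔽_p)` (`sylowU`);
* `exists_conj_U_le` : if `p³ ∣ |H|` for a subgroup `H ≤ GL₃(𝔽_p)` then `x U x⁻¹ ≤ H` for some `x`
  (a Sylow `p`-subgroup of `H` has order `p³`, hence is Sylow in `GL₃(𝔽_p)`, hence conjugate to `U`);
* **`not_cube_dvd_card₁/₂/₃`** : if `(H₁, H₂, H₃)` carries a level-one identity design (verbatim the
  crux's Fourier clause at `k = 1`) then **`p³ ∤ |H₁|`, `p³ ∤ |H₂|`, `p³ ∤ |H₃|`** — every prime `p`,
  every `ε`, NO TPP and no volume hypothesis (`RootChainFrames.no_design_of_cover_conj` with the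
  member alone covering `x (U ∖ 1) x⁻¹`).

Together with the normal-Sylow law (`NormalSylowLaw`, same generation: under the member window a
non-normal Sylow `p`-subgroup of a member of `GL₃` has order `≤ p`) this completes the `p`-LOCAL
TRICHOTOMY at `m = 3`: a member is a `p′`-group, or has a NORMAL Sylow `p`-subgroup of order `p` or
`p²` (and is then reducible), or has exactly `p + 1` or more Sylow subgroups of order `p`.

HONEST SCOPE.  Member law; it empties no `(p, m, ε)` cell.  Sorry-free; standard axioms.
-/

set_option linter.dupNamespace false

noncomputable section

open scoped BigOperators Classical Matrix Pointwise
open Summit.MatrixMultiplication.MatrixMultiplication.Theorems.LieRankDesigns.Negative (GLm Mat)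

namespace Summit.MatrixMultiplication.MatrixMultiplication.Theorems.SubgroupIdentityDesigns.Negative
namespace UnitriangularSylow

open RootChain (U uGL param)
open RootChainFrames (no_design_of_cover_conj)

variable {p : ℕ} [hp : Fact p.Prime]

/-- The standard unitriangular group `U₃ ≤ GL₃(𝔽_p)` (`RootChain.U` in the frame `(0,1,2)`). -/
abbrev U3 : Subgroup (GLm p 3) :=
  U (p := p) (show (0 : Fin 3) ≠ 1 by decide) (show (0 : Fin 3) ≠ 2 by decide)
    (show (1 : Fin 3) ≠ 2 by decide)

/-! ## Orders -/

/-- `|U₃| = p³`. -/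
theorem card_U : Nat.card (U3 (p := p)) = p ^ 3 := by
  rw [← Nat.card_congr (param (p := p) (show (0 : Fin 3) ≠ 1 by decide) (show (0 : Fin 3) ≠ 2 by decide)
    (show (1 : Fin 3) ≠ 2 by decide)), Nat.card_prod, Nat.card_prod,
    Nat.card_eq_fintype_card, ZMod.card]
  ring

/-- `|GL₃(𝔽_p)| = p³ · ((p³ − 1)(p² − 1)(p − 1))`. -/
theorem card_GL3 : Nat.card (GLm p 3) = p ^ 3 * ((p ^ 3 - 1) * ((p ^ 2 - 1) * (p - 1))) := by
  have h := Matrix.card_GL_field (𝔽 := ZMod p) 3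
  rw [Fin.prod_univ_three, ZMod.card] at h
  simp only [Fin.val_zero, Fin.val_one, Fin.val_two, pow_zero, pow_one] at h
  change Nat.card (GLm p 3) = _ at h
  rw [h]
  have hp1 : 1 ≤ p := hp.out.one_lt.le
  have h3 : 1 ≤ p ^ 3 := Nat.one_le_pow _ _ hp1
  have h2 : 1 ≤ p ^ 2 := Nat.one_le_pow _ _ hp1
  have hp3 : p ≤ p ^ 3 := by
    calc p = p ^ 1 := (pow_one p).symm
      _ ≤ p ^ 3 := Nat.pow_le_pow_right hp1 (by norm_num)
  have hp23 : p ^ 2 ≤ p ^ 3 := Nat.pow_le_pow_right hp1 (by norm_num)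
  zify [h3, h2, hp3, hp23, hp1]
  ring

/-- `p ∤ p^k − 1` for `k ≥ 1`. -/
theorem not_dvd_pow_sub_one {k : ℕ} (hk : 1 ≤ k) : ¬ p ∣ p ^ k - 1 := by
  intro h
  have hpk : p ∣ p ^ k := dvd_pow_self p (by omega)
  have h1 : 1 ≤ p ^ k := Nat.one_le_pow _ _ hp.out.pos
  have : p ∣ p ^ k - (p ^ k - 1) := Nat.dvd_sub hpk h
  rw [show p ^ k - (p ^ k - 1) = 1 by omega] at this
  exact hp.out.one_lt.ne' (Nat.dvd_one.mp this)

/-- `v_p |GL₃(𝔽_p)| = 3`. -/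
theorem factorization_card_GL3 : (Nat.card (GLm p 3)).factorization p = 3 := by
  rw [card_GL3]
  have hp1 : 1 < p := hp.out.one_lt
  have hc1 : p ^ 3 - 1 ≠ 0 := by
    have := Nat.one_lt_pow (by norm_num : (3 : ℕ) ≠ 0) hp1; omega
  have hc2 : p ^ 2 - 1 ≠ 0 := by
    have := Nat.one_lt_pow (by norm_num : (2 : ℕ) ≠ 0) hp1; omega
  have hc3 : p - 1 ≠ 0 := by omega
  have hc23 : (p ^ 2 - 1) * (p - 1) ≠ 0 := mul_ne_zero hc2 hc3
  have hc : (p ^ 3 - 1) * ((p ^ 2 - 1) * (p - 1)) ≠ 0 := mul_ne_zero hc1 hc23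
  have hndvd : ¬ p ∣ (p ^ 3 - 1) * ((p ^ 2 - 1) * (p - 1)) := by
    intro h
    rcases (Nat.Prime.dvd_mul hp.out).mp h with h | h
    · exact not_dvd_pow_sub_one (by norm_num) h
    · rcases (Nat.Prime.dvd_mul hp.out).mp h with h | h
      · exact not_dvd_pow_sub_one (by norm_num) h
      · exact not_dvd_pow_sub_one (k := 1) le_rfl (by simpa using h)
  rw [Nat.factorization_mul (pow_ne_zero 3 hp.out.ne_zero) hc, Finsupp.add_apply,
    hp.out.factorization_pow, Finsupp.single_eq_same, Nat.factorization_eq_zero_of_not_dvd hndvd]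

/-- `U₃` is a Sylow `p`-subgroup of `GL₃(𝔽_p)`. -/
def sylowU : Sylow p (GLm p 3) :=
  Sylow.ofCard (U3 (p := p)) (by rw [card_U, factorization_card_GL3])

/-- The underlying subgroup of `sylowU`. -/
theorem coe_sylowU : ((sylowU (p := p)) : Subgroup (GLm p 3)) = U3 := rfl

/-! ## The conjugator -/

/-- **Sylow conjugacy.**  If `p³ ∣ |H|` for `H ≤ GL₃(𝔽_p)` then some conjugate of `U₃` lies in `H`:
`x g x⁻¹ ∈ H` for all `g ∈ U₃`. -/
theorem exists_conj_U_le (H : Subgroup (GLm p 3)) (hdvd : p ^ 3 ∣ Nat.card H) :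
    ∃ x : GLm p 3, ∀ g ∈ (U3 (p := p)), x * g * x⁻¹ ∈ H := by
  obtain ⟨P⟩ : Nonempty (Sylow p H) := inferInstance
  -- `v_p |H| = 3`
  have hle : (Nat.card H).factorization p ≤ 3 := by
    have h3 : (Nat.card (GLm p 3)).factorization p = 3 := factorization_card_GL3
    have hle' : (Nat.card H).factorization p ≤ (Nat.card (GLm p 3)).factorization p :=
      (Nat.factorization_le_iff_dvd Nat.card_pos.ne' Nat.card_pos.ne').mpr
        (Subgroup.card_subgroup_dvd_card H) p
    omega
  have hge : 3 ≤ (Nat.card H).factorization p :=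
    (hp.out.pow_dvd_iff_le_factorization Nat.card_pos.ne').mp hdvd
  have hfac : (Nat.card H).factorization p = 3 := le_antisymm hle hge
  -- the image `N` of `P` in `GL₃` is a Sylow subgroup of `GL₃`
  have hN : Nat.card ((P : Subgroup H).map H.subtype) = p ^ (Nat.card (GLm p 3)).factorization p := by
    rw [Subgroup.card_map_of_injective H.subtype_injective, P.card_eq_multiplicity, hfac,
      factorization_card_GL3]
  obtain ⟨x, hx⟩ := MulAction.exists_smul_eq (GLm p 3) (sylowU (p := p))
    (Sylow.ofCard ((P : Subgroup H).map H.subtype) hN)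
  refine ⟨x, fun g hg => ?_⟩
  have hx' : MulAut.conj x • (U3 (p := p)) = (P : Subgroup H).map H.subtype := by
    have := congrArg (fun Q : Sylow p (GLm p 3) => (Q : Subgroup (GLm p 3))) hx
    simpa only [Sylow.coe_subgroup_smul, coe_sylowU, Sylow.coe_ofCard] using this
  have hmem : x * g * x⁻¹ ∈ MulAut.conj x • (U3 (p := p)) := by
    rw [← MulAut.conj_apply]
    exact Subgroup.smul_mem_pointwise_smul _ _ _ hg
  rw [hx'] at hmem
  obtain ⟨n, -, hn⟩ := Subgroup.mem_map.mp hmem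
  rw [← hn]
  exact n.2

/-! ## The member law -/

section Crux

variable {H₁ H₂ H₃ : Subgroup (GLm p 3)}

/-- **No member of order divisible by `p³` — first member.**  A level-one identity design for
`(H₁, H₂, H₃)` forces `p³ ∤ |H₁|` (every prime `p`; no TPP, no volume hypothesis). -/
theorem not_cube_dvd_card₁
    (hdes : ∃ c : Mat p 3 → ℂ, (∀ M, 1 < M.rank → c M = 0) ∧
      (∑ M, c M * ZMod.stdAddChar (Matrix.trace (M * ((1 : GLm p 3) : Mat p 3)))) = 1 ∧
      ∀ a ∈ H₁, ∀ b ∈ H₂, ∀ g ∈ H₃, a * b * g ≠ 1 →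
        (∑ M, c M * ZMod.stdAddChar (Matrix.trace (M * ((a * b * g : GLm p 3) : Mat p 3)))) = 0) :
    ¬ p ^ 3 ∣ Nat.card H₁ := by
  intro hdvd
  obtain ⟨x, hx⟩ := exists_conj_U_le H₁ hdvd
  refine no_design_of_cover_conj (show (0 : Fin 3) ≠ 1 by decide) (show (0 : Fin 3) ≠ 2 by decide)
    (show (1 : Fin 3) ≠ 2 by decide) (H₁ := H₁) (H₂ := H₂) (H₃ := H₃) x ?_ hdes
  intro g hg _
  exact ⟨x * g * x⁻¹, hx g hg, 1, H₂.one_mem, 1, H₃.one_mem, by rw [mul_one, mul_one]⟩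

/-- **No member of order divisible by `p³` — middle member.** -/
theorem not_cube_dvd_card₂
    (hdes : ∃ c : Mat p 3 → ℂ, (∀ M, 1 < M.rank → c M = 0) ∧
      (∑ M, c M * ZMod.stdAddChar (Matrix.trace (M * ((1 : GLm p 3) : Mat p 3)))) = 1 ∧
      ∀ a ∈ H₁, ∀ b ∈ H₂, ∀ g ∈ H₃, a * b * g ≠ 1 →
        (∑ M, c M * ZMod.stdAddChar (Matrix.trace (M * ((a * b * g : GLm p 3) : Mat p 3)))) = 0) :
    ¬ p ^ 3 ∣ Nat.card H₂ := by
  intro hdvd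
  obtain ⟨x, hx⟩ := exists_conj_U_le H₂ hdvd
  refine no_design_of_cover_conj (show (0 : Fin 3) ≠ 1 by decide) (show (0 : Fin 3) ≠ 2 by decide)
    (show (1 : Fin 3) ≠ 2 by decide) (H₁ := H₁) (H₂ := H₂) (H₃ := H₃) x ?_ hdes
  intro g hg _
  exact ⟨1, H₁.one_mem, x * g * x⁻¹, hx g hg, 1, H₃.one_mem, by rw [one_mul, mul_one]⟩

/-- **No member of order divisible by `p³` — third member.** -/
theorem not_cube_dvd_card₃
    (hdes : ∃ c : Mat p 3 → ℂ, (∀ M, 1 < M.rank → c M = 0) ∧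
      (∑ M, c M * ZMod.stdAddChar (Matrix.trace (M * ((1 : GLm p 3) : Mat p 3)))) = 1 ∧
      ∀ a ∈ H₁, ∀ b ∈ H₂, ∀ g ∈ H₃, a * b * g ≠ 1 →
        (∑ M, c M * ZMod.stdAddChar (Matrix.trace (M * ((a * b * g : GLm p 3) : Mat p 3)))) = 0) :
    ¬ p ^ 3 ∣ Nat.card H₃ := by
  intro hdvd
  obtain ⟨x, hx⟩ := exists_conj_U_le H₃ hdvd
  refine no_design_of_cover_conj (show (0 : Fin 3) ≠ 1 by decide) (show (0 : Fin 3) ≠ 2 by decide)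
    (show (1 : Fin 3) ≠ 2 by decide) (H₁ := H₁) (H₂ := H₂) (H₃ := H₃) x ?_ hdes
  intro g hg _
  exact ⟨1, H₁.one_mem, 1, H₂.one_mem, x * g * x⁻¹, hx g hg, by rw [one_mul, one_mul]⟩

/-- **`v_p |Hᵢ| ≤ 2` for every member**: the Sylow `p`-subgroups of the members of a level-one design
triple in `GL₃(𝔽_p)` have order `1`, `p` or `p²`. -/
theorem card_sylow_le_sq
    (hdes : ∃ c : Mat p 3 → ℂ, (∀ M, 1 < M.rank → c M = 0) ∧
      (∑ M, c M * ZMod.stdAddChar (Matrix.trace (M * ((1 : GLm p 3) : Mat p 3)))) = 1 ∧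
      ∀ a ∈ H₁, ∀ b ∈ H₂, ∀ g ∈ H₃, a * b * g ≠ 1 →
        (∑ M, c M * ZMod.stdAddChar (Matrix.trace (M * ((a * b * g : GLm p 3) : Mat p 3)))) = 0) :
    (∀ P : Sylow p H₁, Nat.card P ≤ p ^ 2) ∧ (∀ P : Sylow p H₂, Nat.card P ≤ p ^ 2) ∧
      (∀ P : Sylow p H₃, Nat.card P ≤ p ^ 2) := by
  have key : ∀ (H : Subgroup (GLm p 3)), ¬ p ^ 3 ∣ Nat.card H → ∀ P : Sylow p H,
      Nat.card P ≤ p ^ 2 := by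
    intro H h3 P
    rw [P.card_eq_multiplicity]
    apply Nat.pow_le_pow_right hp.out.pos
    by_contra hlt
    exact h3 ((hp.out.pow_dvd_iff_le_factorization Nat.card_pos.ne').mpr (by omega))
  exact ⟨key H₁ (not_cube_dvd_card₁ hdes), key H₂ (not_cube_dvd_card₂ hdes),
    key H₃ (not_cube_dvd_card₃ hdes)⟩

end Crux

end UnitriangularSylow
end Summit.MatrixMultiplication.MatrixMultiplication.Theorems.SubgroupIdentityDesigns.Negative

end
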